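import Literature.Analysis.SpecialFunctions.DigammaStirlingSeries
import HarnessLib

/-!
# Lehman's Stirling-type estimate for the digamma function,
# `ψ(z) = log z − 1/(2z) + Θ(2/(π²|(Im z)² − (Re z)²|))` (Lehman 1970 Lemma 8; Booker 2006 (4.3); Trudgian 2011 Lemma 2.9)

Topic `Literature/Analysis/SpecialFunctions`; namespace `Literature.Analysis.SpecialFunctions`,
sub-namespace `DigammaLehman`. Sibling of `DigammaStirlingSeries.lean` (Stirling's series for `ψ` of
every order `ν ≥ 1` with remainder `(π²/3)(2ν+1)!/(2π)^{2ν+1}/(‖w‖^{2ν} Re w)` — a factor `1/Re w`),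
`DigammaStirlingSecondOrder.lean` (`|Re/Im (ψ(w) − Log w + 1/(2w))| ≤ 1/(6|Im w|³) + π/(12 (Im w)²)` —
powers of `1/|Im w|`) and `DigammaGauss.lean` (Gauss's formula). Everything here is PROVED (kernel
lane; no definitions, no named facts). Typed for the parity-realchar cell (D-0088 (4)
literature-typing layer, row «Platt 2016 / Platt–Trudgian 2021 / Booker 2006»): this is the
digamma input of Booker's Lemma 5.7 = Platt's Lemma 7.6 (time-domain aliasing of Algorithm 2) and of
Booker's Lemma 4.3 / Trudgian's Lemma 2.10 / Rumely's Theorem 2 (Turing's method), where the tree so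
far substituted its own weaker constants (e.g. `Booker2006Turing.abs_re_digamma_half_sub_le`,
`CertifiedDirichletLTuringBooker.lean`: "Booker's Stirling-type estimate (4.3) … with the tree's
constants").

## The statement in print

* Lehman 1970, Lemma 8 (p. 308), as quoted verbatim by Rumely, Math. Comp. 61 (1993) p. 431, (23):
  "According to [8, Lemma 8, p. 308], if `Re(z) > 0`, then
  `Γ'(z)/Γ(z) = ln(z) − 1/(2z) + θ(2/(π² |Im(z)² − Re(z)²|))`."
* Trudgian 2011, Lemma 2.9: "Define the symbol `Θ` in the following way: `f(x) = Θ{g(x)}` means that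
  `|f(x)| ≤ g(x)`. If `Re z > 0`, then `Γ'(z)/Γ(z) = log z − 1/(2z) + Θ(2/(π²|(Im z)² − (Re z)²|))`.
  Proof. See [Lehman]." (arXiv:0903.1885 §2.)
* Booker 2006, §4, display (4.3) (arXiv:math/0507502 p. 13): "We apply the Stirling-type estimate
  [Lehman] `Γ'/Γ(z) = log z − 1/(2z) + Θ(2/π²/|Im(z)² − Re(z)²|)` for `Re(z) ≥ 0`."

## What is here (all proved)

* `norm_digamma_sub_stirling_two_le` — **the second-order Stirling formula for `ψ` with a uniform
  remainder on the right half-plane**: for `Re w > 0`,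
  `‖ψ(w) − (Log w − 1/(2w) − 1/(12w²))‖ ≤ (√3π/144)/‖w‖³` (`√3π/144 = 0.0378`).
* `norm_digamma_sub_log_add_inv_le` — `‖ψ(w) − Log w + 1/(2w)‖ ≤ 1/(12‖w‖²) + (√3π/144)/‖w‖³`;
  `abs_re_digamma_sub_log_norm_add_le`, `abs_im_digamma_sub_arg_sub_le` — its real and imaginary
  parts (`Re Log w = log‖w‖`, `Im Log w = arg w`, `1/(2w) = (Re w − i Im w)/(2‖w‖²)`).
* `norm_digamma_sub_log_add_inv_mul_sq_le` — for `Re z > 0`, `‖z‖ ≥ 1/3`: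
  `‖ψ(z) − Log z + 1/(2z)‖ ‖z‖² ≤ 2/π²`; hence (`|(Im z)² − (Re z)²| ≤ ‖z‖²`) **Lehman's estimate as
  printed, for `‖z‖ ≥ 1/3`**: `norm_digamma_sub_log_add_inv_le_lehman`
  (`‖ψ(z) − Log z + 1/(2z)‖ ≤ 2/(π²|(Im z)² − (Re z)²|)`, off the diagonals) and the multiplicative
  `Θ`-form `norm_digamma_sub_log_add_inv_mul_le_lehman` (no side condition on the diagonals).
  RESTRICTION RECORDED (not a silent weakening): print has no lower bound on `‖z‖`; the
  asymptotic-series proof needs `1/12 + 0.0378/‖z‖ ≤ 2/π²`, i.e. `‖z‖ ≥ 0.317`. Every use in the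
  row's sources has `z = (1/2 + a + it)/2`, `a ∈ {0, 1}`, so `‖z‖ ≥ 1/4`, and `‖z‖ ≥ 1/3` as soon as
  `|t| ≥ 0.45` (`a = 0`) or always (`a = 1`).
  `-- TODO(general form): all Re z > 0` — the Binet–Laplace representation
  `ψ(z) = Log z − 1/(2z) − ∫₀^∞ φ(t)e^{−zt} dt`, `φ(t) = 1/(eᵗ−1) − 1/t + ½` (concave, `φ(0)=0`,
  `φ'(0) = 1/12`), integrated by parts twice, gives `|ψ(z) − Log z + 1/(2z)| ≤ 1/(6‖z‖²)` uniformly,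
  which implies the printed bound everywhere (`π² ≤ 12`); that representation is not in the tree.
* Tools: `abs_bernoulliPer_three_le_sharp` (`|B̄₃| ≤ √3/36`, sharp; the tree had `1/8`),
  `div_one_add_sq_le_arctan` (`v/(1+v²) ≤ arctan v`), `integral_inv_sq_add_sq_sq_le`
  (`∫₀ⁿ dx/(c²+x²)² ≤ π/(4c³)`).

## Proof

Euler–Maclaurin summation of order one (the tree's
`Literature.Barriers.RiemannHypothesis.Lemma2.eulerMaclaurin_family`) for the derivative family
`g_j(x) = (−1)^j j!/(w+x)^{j+1}` on `[0, n]`: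
`Σ_{j≤n} 1/(w+j) = Log(w+n) − Log w + (1/w + 1/(w+n))/2 + (1/12)(1/w² − 1/(w+n)²) − ∫₀ⁿ B̄₃(x)(w+x)^{−4} dx`;
Gauss's formula `ψ(w) = lim (log n − Σ_{j≤n} 1/(w+j))` (the tree's `tendsto_log_sub_sum_inv_digamma`)
and `log n − Log(w+n) → 0`, `(w+n)^{−p} → 0` give
`ψ(w) − Log w + 1/(2w) + 1/(12w²) = ∫₀^∞ B̄₃(x)(w+x)^{−4} dx`; then `|B̄₃| ≤ √3/36`
(`B₃(y)² = p²(¼−p)`, `p = y(1−y)`, and `1/432 − p²(¼−p) = (p−1/6)²(p+1/12)`),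
`‖w+x‖² ≥ ‖w‖² + x²` (`Re w > 0`, `x ≥ 0`) and `∫₀^∞ dx/(‖w‖²+x²)² = π/(4‖w‖³)` (antiderivative
`x/(2c²(c²+x²)) + arctan(x/c)/(2c³)`, bounded using `v/(1+v²) ≤ arctan v`). The numerics of the
Lehman form: `√3 ≤ 1.7321`, `π ≤ 3.1416`, `1/12 + 3·√3π/144 ≤ 0.1967 ≤ 2/π²`.

`lean search` (2026-08-27): `Lehman`/`Lemma 2.9`/`2/(π²…)` digamma bounds — none in the tree or Mathlib
(the tree's second-order bounds are the `1/Re w` and `1/|Im w|` forms cited above; Booker's (4.3) is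
quoted in `CertifiedDirichletLTuringBooker.lean` with "the tree's constants"). Reused:
`eulerMaclaurin_family`, `bernoulliPer`/`bernoulliFun_three` (`EulerMaclaurinZeta.lean`),
`tendsto_log_sub_sum_inv_digamma` (`DigammaGauss.lean`); the private limit lemmas follow
`DigammaStirlingSeries.lean`. Mathlib: `Real.hasDerivAt_arctan`, `Real.arctan_inv_of_pos`,
`monotoneOn_of_deriv_nonneg`, `bernoulli'_two`, `intervalIntegral.norm_integral_le_of_norm_le`.

## References

* [Lehman1970] R. S. Lehman, *On the distribution of zeros of the Riemann zeta-function*, Proc. London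
  Math. Soc. (3) 20 (1970) 303–320, Lemma 8 p. 308 (not held; statement taken verbatim from Rumely
  1993 (23) and Trudgian 2011 Lemma 2.9, both held).
* [Rumely1993ERH] R. Rumely, *Numerical computations concerning the ERH*, Math. Comp. 61 (1993)
  415–440, §4 (23) p. 431.
* [Trudgian2011] T. S. Trudgian, *Improvements to Turing's method*, Math. Comp. 80 (2011) 2259–2279,
  Lemma 2.9 (arXiv:0903.1885 §2).
* [Booker2006] A. R. Booker, *Artin's conjecture, Turing's method, and the Riemann hypothesis*,
  Experiment. Math. 15 (2006) 385–407, §4 (4.3) (arXiv:math/0507502 p. 13).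
* [WhittakerWatson1927] E. T. Whittaker, G. N. Watson, *A Course of Modern Analysis*, 4th ed., §12.33.
* [DLMF] NIST Digital Library of Mathematical Functions, 5.11.2 (asymptotic expansion of `ψ`), Table 24.2.2,
  4.23.3.
-/

noncomputable section

open Complex Real Set Filter Topology MeasureTheory intervalIntegral

namespace Literature.Analysis.SpecialFunctions

namespace DigammaLehman

open Literature.NumberTheory.LFunctions (bernoulliPer bernoulliPer_def bernoulliFun_three
  measurable_bernoulliPer)
open Literature.Barriers.RiemannHypothesis.Lemma2 (eulerMaclaurin_family)
open Literature.Analysis.SpecialFunctions.Complex (tendsto_log_sub_sum_inv_digamma)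

/-! ### The sharp bound `|B̄₃| ≤ √3/36` -/

/-- **The sharp bound for the third periodic Bernoulli function:** `|B̄₃(x)| ≤ √3/36` for all real `x`
(`B₃(y) = y(y−½)(y−1)`; with `p = y(1−y) ∈ [0, ¼]`, `B₃(y)² = p²(¼ − p) ≤ 1/432`, equality at
`p = 1/6`). [cite: DLMF, Table 24.2.2 (B₃(x) = x³ − 3x²/2 + x/2) and §24.2(iii)] -/
theorem abs_bernoulliPer_three_le_sharp (x : ℝ) : |bernoulliPer 3 x| ≤ Real.sqrt 3 / 36 := by
  rw [bernoulliPer_def, bernoulliFun_three]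
  set y := Int.fract x with hy
  have h0 : 0 ≤ y := Int.fract_nonneg x
  have h1 : y < 1 := Int.fract_lt_one x
  set p := y * (1 - y) with hp
  have hp0 : 0 ≤ p := mul_nonneg h0 (by linarith)
  have hsq : (y ^ 3 - 3 / 2 * y ^ 2 + 1 / 2 * y) ^ 2 = p ^ 2 * (1 / 4 - p) := by
    rw [hp]; ring
  have hle : (y ^ 3 - 3 / 2 * y ^ 2 + 1 / 2 * y) ^ 2 ≤ (Real.sqrt 3 / 36) ^ 2 := by
    rw [hsq, div_pow, Real.sq_sqrt (by norm_num : (0 : ℝ) ≤ 3)]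
    have key : 1 / 432 - p ^ 2 * (1 / 4 - p) = (p - 1 / 6) ^ 2 * (p + 1 / 12) := by ring
    nlinarith [key, sq_nonneg (p - 1 / 6)]
  exact abs_le_of_sq_le_sq' hle (by positivity) |>.elim (fun h1 h2 => abs_le.mpr ⟨h1, h2⟩)

/-! ### The kernel `(w + x)^{-4}` and `∫₀^∞ dx/(‖w‖² + x²)² = π/(4‖w‖³)` -/

/-- `v/(1+v²) ≤ arctan v` for `v ≥ 0` (the integrand `1/(1+t²)` of `arctan v = ∫₀^v` is decreasing).
[cite: DLMF, Eq. 4.23.3 (arctan as an integral)] -/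
theorem div_one_add_sq_le_arctan {v : ℝ} (hv : 0 ≤ v) : v / (1 + v ^ 2) ≤ Real.arctan v := by
  -- `h(u) = arctan u − u/(1+u²)` is monotone on `[0, ∞)` (`h' = 2u²/(1+u²)² ≥ 0`) and `h(0) = 0`
  let h : ℝ → ℝ := fun u => Real.arctan u - u / (1 + u ^ 2)
  have hderiv : ∀ u : ℝ, HasDerivAt h (2 * u ^ 2 / (1 + u ^ 2) ^ 2) u := by
    intro u
    have h1 := Real.hasDerivAt_arctan u
    have hne : (1 + u ^ 2) ≠ 0 := by positivity
    have h2 : HasDerivAt (fun u : ℝ => u / (1 + u ^ 2)) ((1 * (1 + u ^ 2) - u * (2 * u)) / (1 + u ^ 2) ^ 2) u := by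
      have hd : HasDerivAt (fun u : ℝ => 1 + u ^ 2) (2 * u) u := by
        have := (hasDerivAt_pow 2 u).const_add 1
        simpa using this
      exact (hasDerivAt_id u).div hd hne
    have h3 := h1.sub h2
    refine h3.congr_deriv ?_
    field_simp
    ring
  have hmono : MonotoneOn h (Ici 0) := by
    refine monotoneOn_of_deriv_nonneg (convex_Ici 0) ?_ ?_ ?_
    · exact fun u _ => (hderiv u).continuousAt.continuousWithinAt
    · exact fun u _ => (hderiv u).differentiableAt.differentiableWithinAt
    · intro u _
      rw [(hderiv u).deriv]
      positivity
  have h0 : h 0 = 0 := by simp [h]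
  have := hmono (self_mem_Ici) (mem_Ici.mpr hv) hv
  rw [h0] at this
  simp only [h] at this
  linarith

/-- `∫₀ⁿ dx/(c² + x²)² ≤ π/(4c³)` for `c > 0`, `n ≥ 0` (antiderivative
`x/(2c²(c²+x²)) + arctan(x/c)/(2c³)`, and `cn/(c²+n²) + arctan(n/c) ≤ π/2`).
[cite: DLMF, Eq. 4.23.3 (arctan as an integral)] -/
theorem integral_inv_sq_add_sq_sq_le {c : ℝ} (hc : 0 < c) {n : ℝ} (hn : 0 ≤ n) :
    ∫ x in (0 : ℝ)..n, ((c ^ 2 + x ^ 2) ^ 2)⁻¹ ≤ π / (4 * c ^ 3) := by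
  let F : ℝ → ℝ := fun x => x / (2 * c ^ 2 * (c ^ 2 + x ^ 2)) + Real.arctan (x / c) / (2 * c ^ 3)
  have hderiv : ∀ x ∈ uIcc (0 : ℝ) n, HasDerivAt F (((c ^ 2 + x ^ 2) ^ 2)⁻¹) x := by
    intro x _
    have hpos : 0 < c ^ 2 + x ^ 2 := by positivity
    have hd1 : HasDerivAt (fun x : ℝ => 2 * c ^ 2 * (c ^ 2 + x ^ 2)) (2 * c ^ 2 * (2 * x)) x := by
      have := ((hasDerivAt_pow 2 x).const_add (c ^ 2)).const_mul (2 * c ^ 2)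
      simpa using this
    have hq : HasDerivAt (fun x : ℝ => x / (2 * c ^ 2 * (c ^ 2 + x ^ 2)))
        ((1 * (2 * c ^ 2 * (c ^ 2 + x ^ 2)) - x * (2 * c ^ 2 * (2 * x))) /
          (2 * c ^ 2 * (c ^ 2 + x ^ 2)) ^ 2) x :=
      (hasDerivAt_id x).div hd1 (by positivity)
    have ha : HasDerivAt (fun x : ℝ => Real.arctan (x / c) / (2 * c ^ 3))
        ((1 / (1 + (x / c) ^ 2)) * (1 / c) / (2 * c ^ 3)) x := by
      have h1 : HasDerivAt (fun x : ℝ => x / c) (1 / c) x := by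
        simpa using (hasDerivAt_id x).div_const c
      exact ((Real.hasDerivAt_arctan (x / c)).comp x h1).div_const (2 * c ^ 3)
    have hsum := hq.add ha
    refine hsum.congr_deriv ?_
    field_simp
    ring
  have hcont : ContinuousOn (fun x : ℝ => ((c ^ 2 + x ^ 2) ^ 2)⁻¹) (uIcc (0 : ℝ) n) := by
    refine ContinuousOn.inv₀ (by fun_prop) fun x _ => by positivity
  have hint : IntervalIntegrable (fun x : ℝ => ((c ^ 2 + x ^ 2) ^ 2)⁻¹) volume 0 n :=
    hcont.intervalIntegrable
  rw [integral_eq_sub_of_hasDerivAt hderiv hint]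
  have hF0 : F 0 = 0 := by simp [F]
  rw [hF0, sub_zero]
  simp only [F]
  -- `c n/(c²+n²) + arctan(n/c) ≤ π/2`
  have hkey : c * n / (c ^ 2 + n ^ 2) + Real.arctan (n / c) ≤ π / 2 := by
    rcases hn.eq_or_lt with h0 | hpos
    · rw [← h0]; simp; positivity
    · have hinv : Real.arctan (n / c) = π / 2 - Real.arctan (c / n) := by
        rw [show n / c = (c / n)⁻¹ by rw [inv_div], Real.arctan_inv_of_pos (by positivity)]
      have hlow := div_one_add_sq_le_arctan (v := c / n) (by positivity)
      have e : c / n / (1 + (c / n) ^ 2) = c * n / (c ^ 2 + n ^ 2) := by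
        field_simp
        ring
      rw [e] at hlow
      linarith
  have hc3 : 0 < 2 * c ^ 3 := by positivity
  have e1 : n / (2 * c ^ 2 * (c ^ 2 + n ^ 2)) = (c * n / (c ^ 2 + n ^ 2)) / (2 * c ^ 3) := by
    field_simp
  rw [e1, ← add_div, div_le_div_iff₀ hc3 (by positivity)]
  nlinarith [hkey, hc3]

/-- `w + x ≠ 0` for `Re w > 0`, `x ≥ 0`. [folklore] -/
private lemma add_ofReal_ne_zero {w : ℂ} (hw : 0 < w.re) {x : ℝ} (hx : 0 ≤ x) : w + (x : ℂ) ≠ 0 := by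
  intro h
  have := congrArg Complex.re h
  simp at this
  linarith

/-- `‖(w + x)^{-4}‖ ≤ 1/(‖w‖² + x²)²` for `Re w > 0`, `x ≥ 0` (`‖w + x‖² = ‖w‖² + 2x Re w + x²`).
[folklore] -/
private lemma norm_zpow_neg_four_le {w : ℂ} (hw : 0 < w.re) {x : ℝ} (hx : 0 ≤ x) :
    ‖(w + x) ^ (-(4 : ℤ))‖ ≤ ((‖w‖ ^ 2 + x ^ 2) ^ 2)⁻¹ := by
  have hsq : ‖w‖ ^ 2 + x ^ 2 ≤ ‖w + (x : ℂ)‖ ^ 2 := by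
    rw [Complex.sq_norm, Complex.sq_norm, Complex.normSq_apply, Complex.normSq_apply]
    simp only [add_re, ofReal_re, add_im, ofReal_im, add_zero]
    nlinarith
  have hpos : 0 < ‖w‖ ^ 2 + x ^ 2 := by
    have : 0 < ‖w‖ := norm_pos_iff.mpr (fun h ↦ by rw [h] at hw; simp at hw)
    positivity
  rw [zpow_neg, norm_inv, show (4 : ℤ) = ((4 : ℕ) : ℤ) by norm_num, zpow_natCast, norm_pow]
  refine inv_anti₀ (by positivity) ?_
  calc (‖w‖ ^ 2 + x ^ 2) ^ 2 ≤ (‖w + (x : ℂ)‖ ^ 2) ^ 2 := by gcongr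
    _ = ‖w + (x : ℂ)‖ ^ 4 := by ring

/-- The remainder kernel bound, uniformly in `n`:
`‖∫₀ⁿ B̄₃(x) (w+x)^{-4} dx‖ ≤ (√3/36)(π/(4‖w‖³))`. [folklore] -/
private lemma norm_integral_bernoulliPer_three_mul_le {w : ℂ} (hw : 0 < w.re) (n : ℕ) :
    ‖∫ x in (0 : ℝ)..n, (bernoulliPer 3 x : ℂ) * (w + x) ^ (-(4 : ℤ))‖ ≤
      Real.sqrt 3 / 36 * (π / (4 * ‖w‖ ^ 3)) := by
  have hwpos : 0 < ‖w‖ := norm_pos_iff.mpr (fun h ↦ by rw [h] at hw; simp at hw)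
  have hn0 : (0 : ℝ) ≤ n := Nat.cast_nonneg n
  set K : ℝ := Real.sqrt 3 / 36 with hK
  have hK0 : 0 ≤ K := by positivity
  have hpt : ∀ᵐ x : ℝ, x ∈ Ioc (0 : ℝ) n →
      ‖(bernoulliPer 3 x : ℂ) * (w + x) ^ (-(4 : ℤ))‖ ≤ K * ((‖w‖ ^ 2 + x ^ 2) ^ 2)⁻¹ := by
    refine ae_of_all _ fun x hx ↦ ?_
    rw [norm_mul, Complex.norm_real, Real.norm_eq_abs]
    exact mul_le_mul (abs_bernoulliPer_three_le_sharp x) (norm_zpow_neg_four_le hw hx.1.le)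
      (norm_nonneg _) hK0
  have hcont : ContinuousOn (fun x : ℝ => K * ((‖w‖ ^ 2 + x ^ 2) ^ 2)⁻¹) (uIcc (0 : ℝ) n) := by
    refine ContinuousOn.mul continuousOn_const (ContinuousOn.inv₀ (by fun_prop) fun x _ => ?_)
    positivity
  have hint : IntervalIntegrable (fun x : ℝ => K * ((‖w‖ ^ 2 + x ^ 2) ^ 2)⁻¹) volume 0 n :=
    hcont.intervalIntegrable
  calc ‖∫ x in (0 : ℝ)..n, (bernoulliPer 3 x : ℂ) * (w + x) ^ (-(4 : ℤ))‖
      ≤ ∫ x in (0 : ℝ)..n, K * ((‖w‖ ^ 2 + x ^ 2) ^ 2)⁻¹ :=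
        intervalIntegral.norm_integral_le_of_norm_le hn0 hpt hint
    _ = K * ∫ x in (0 : ℝ)..n, ((‖w‖ ^ 2 + x ^ 2) ^ 2)⁻¹ := intervalIntegral.integral_const_mul _ _
    _ ≤ K * (π / (4 * ‖w‖ ^ 3)) :=
        mul_le_mul_of_nonneg_left (integral_inv_sq_add_sq_sq_le hwpos hn0) hK0

/-! ### Euler–Maclaurin of order one for `1/(w+x)` and the limit -/

/-- The family `g_j(x) = (−1)^j j! (w+x)^{-(j+1)}` is a derivative family on `[0, ∞)`. [folklore] -/
private lemma hasDerivAt_gFam {w : ℂ} (hw : 0 < w.re) (j : ℕ) {x : ℝ} (hx : 0 ≤ x) :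
    HasDerivAt (fun y : ℝ ↦ (-1 : ℂ) ^ j * (j.factorial : ℂ) * (w + y) ^ (-(j + 1 : ℤ)))
      ((-1 : ℂ) ^ (j + 1) * ((j + 1).factorial : ℂ) * (w + x) ^ (-(j + 1 + 1 : ℤ))) x := by
  have hne : w + (x : ℂ) ≠ 0 := add_ofReal_ne_zero hw hx
  have h1 := hasDerivAt_zpow (-(j + 1 : ℤ)) (w + (x : ℂ)) (Or.inl hne)
  have h2 : HasDerivAt (fun z : ℂ ↦ w + z) 1 (x : ℂ) := (hasDerivAt_id _).const_add w
  have h3 := (h1.comp (x : ℂ) h2).comp_ofReal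
  have h4 := h3.const_mul ((-1 : ℂ) ^ j * (j.factorial : ℂ))
  simp only [Function.comp_def, mul_one] at h4
  refine h4.congr_deriv ?_
  have e : (-(j + 1 : ℤ) - 1 : ℤ) = -(j + 1 + 1 : ℤ) := by ring
  rw [e, Nat.factorial_succ]
  push_cast
  ring

/-- `∫_0^n dx/(w+x) = Log(w+n) − Log w` for `Re w > 0`. [folklore] -/
private lemma integral_gFam_zero {w : ℂ} (hw : 0 < w.re) (n : ℕ) :
    ∫ x in (0 : ℝ)..n, (-1 : ℂ) ^ 0 * ((0 : ℕ).factorial : ℂ) * (w + x) ^ (-(0 + 1 : ℤ))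
      = Complex.log (w + n) - Complex.log w := by
  have hderiv : ∀ x ∈ uIcc (0 : ℝ) n, HasDerivAt (fun y : ℝ ↦ Complex.log (w + y)) ((w + x)⁻¹) x := by
    intro x hx
    rw [uIcc_of_le (Nat.cast_nonneg n)] at hx
    have hslit : w + (x : ℂ) ∈ slitPlane := Or.inl (by simp; linarith [hx.1])
    have h2 : HasDerivAt (fun y : ℝ ↦ w + (y : ℂ)) 1 x := by
      simpa using ((hasDerivAt_id x).ofReal_comp).const_add w
    have h3 := h2.clog_real hslit
    simpa [one_div] using h3
  have hcont : ContinuousOn (fun x : ℝ ↦ (w + x)⁻¹) (uIcc (0 : ℝ) n) := by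
    rw [uIcc_of_le (Nat.cast_nonneg n)]
    refine ContinuousOn.inv₀ (by fun_prop) fun x hx ↦ add_ofReal_ne_zero hw hx.1
  have := integral_eq_sub_of_hasDerivAt hderiv (hcont.intervalIntegrable)
  simp only [pow_zero, Nat.factorial_zero, Nat.cast_one, one_mul, zero_add] at this ⊢
  rw [show (-(1 : ℤ)) = -1 from rfl]
  simp_rw [zpow_neg_one]
  simpa using this

/-- `Σ_{j ≤ n} f j = f 0 + Σ_{0 < m ≤ n} f m`. [folklore] -/
private lemma sum_range_succ_eq_add_sum_Ioc {M : Type*} [AddCommMonoid M] (f : ℕ → M) (n : ℕ) :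
    ∑ j ∈ Finset.range (n + 1), f j = f 0 + ∑ m ∈ Finset.Ioc 0 n, f m := by
  induction n with
  | zero => simp
  | succ n ih => rw [Finset.sum_range_succ, ih, Finset.sum_Ioc_succ_top (Nat.zero_le _), add_assoc]

/-- `log n − Log(w + n) → 0` in `ℂ` (`Re w > 0`). [folklore] -/
private lemma tendsto_log_nat_sub_clog_add {w : ℂ} (hw : 0 < w.re) :
    Tendsto (fun n : ℕ ↦ (Real.log n : ℂ) - Complex.log (w + n)) atTop (𝓝 0) := by
  have h1 : Tendsto (fun n : ℕ ↦ w / n + 1) atTop (𝓝 1) := by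
    have := (tendsto_const_div_atTop_nhds_zero_nat w).add (tendsto_const_nhds (x := (1 : ℂ)))
    simpa using this
  have h2 : Tendsto (fun n : ℕ ↦ Complex.log (w / n + 1)) atTop (𝓝 0) := by
    have hc : ContinuousAt Complex.log 1 := continuousAt_clog (by simp [slitPlane])
    have := hc.tendsto.comp h1
    rw [Complex.log_one] at this
    exact this
  have h3 : ∀ᶠ n : ℕ in atTop, (Real.log n : ℂ) - Complex.log (w + n) = -Complex.log (w / n + 1) := by
    filter_upwards [eventually_ne_atTop 0] with n hn
    have hn0 : (0 : ℝ) < n := Nat.cast_pos.2 (Nat.pos_of_ne_zero hn)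
    have hne : w / n + 1 ≠ 0 := by
      intro h
      have := congrArg Complex.re h
      simp [Complex.div_re] at this
      have : w.re / n + 1 = 0 := by
        have e : w.re * n / (n * n : ℝ) = w.re / n := by field_simp
        linarith [e]
      have : 0 < w.re / n + 1 := by positivity
      linarith
    have hwn : w + n = (n : ℝ) * (w / n + 1) := by
      have : (n : ℂ) ≠ 0 := by exact_mod_cast hn
      push_cast
      field_simp
    rw [hwn, Complex.log_ofReal_mul hn0 hne]
    push_cast
    ring
  rw [tendsto_congr' h3]
  simpa using h2.neg

/-- `((w + n)^p)⁻¹ → 0` for `p ≥ 1` (`Re w > 0`). [folklore] -/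
private lemma tendsto_inv_pow_add_nat {w : ℂ} (hw : 0 < w.re) {p : ℕ} (hp : 1 ≤ p) :
    Tendsto (fun n : ℕ ↦ ((w + n) ^ p)⁻¹) atTop (𝓝 0) := by
  refine squeeze_zero_norm' ?_ tendsto_one_div_atTop_nhds_zero_nat
  filter_upwards [eventually_ge_atTop 1] with n hn
  have hn1 : (1 : ℝ) ≤ n := by exact_mod_cast hn
  have hre : (n : ℝ) ≤ ‖w + n‖ := by
    have := Complex.re_le_norm (w + n)
    simp at this
    linarith
  rw [norm_inv, norm_pow, one_div]
  refine inv_anti₀ (by positivity) ?_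
  calc (n : ℝ) ≤ (n : ℝ) ^ p := le_self_pow₀ hn1 (by omega)
    _ ≤ ‖w + n‖ ^ p := pow_le_pow_left₀ (by positivity) hre p

/-- **Stirling for `ψ` to second order with an explicit remainder, uniformly on `Re w > 0`:**
`‖ψ(w) − (Log w − 1/(2w) − 1/(12w²))‖ ≤ (√3 π/144) / ‖w‖³`.
Euler–Maclaurin summation of order one for `1/(w+x)` (the tree's `eulerMaclaurin_family`),
`ψ(w) = lim (log n − Σ_{j≤n} 1/(w+j))` (Gauss; the tree's `tendsto_log_sub_sum_inv_digamma`), whence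
`ψ(w) − Log w + 1/(2w) + 1/(12w²) = ∫₀^∞ B̄₃(x)(w+x)^{-4} dx`, and `|B̄₃| ≤ √3/36`,
`‖w+x‖² ≥ ‖w‖² + x²`, `∫₀^∞ dx/(‖w‖²+x²)² = π/(4‖w‖³)`.
[cite: WhittakerWatson1927, §12.33 (the asymptotic expansion of log Γ and ψ)] [cite: DLMF, Eq. 5.11.2] -/
theorem norm_digamma_sub_stirling_two_le {w : ℂ} (hw : 0 < w.re) :
    ‖Complex.digamma w - (Complex.log w - 1 / (2 * w) - 1 / (12 * w ^ 2))‖ ≤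
      Real.sqrt 3 * π / 144 / ‖w‖ ^ 3 := by
  set G : ℕ → ℝ → ℂ := fun j y ↦ (-1 : ℂ) ^ j * (j.factorial : ℂ) * (w + y) ^ (-(j + 1 : ℤ)) with hG
  set Main : ℂ := Complex.log w - 1 / (2 * w) - 1 / (12 * w ^ 2) with hMain
  set Bnd : ℝ := Real.sqrt 3 / 36 * (π / (4 * ‖w‖ ^ 3)) with hBnd
  have hw0 : w ≠ 0 := fun h ↦ by rw [h] at hw; simp at hw
  have hG0 : ∀ y : ℝ, G 0 y = (w + y)⁻¹ := by intro y; simp [hG]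
  have hG1 : ∀ y : ℝ, G 1 y = -((w + y) ^ 2)⁻¹ := by
    intro y
    simp only [hG, pow_one, Nat.factorial_one, Nat.cast_one, mul_one]
    norm_num
    exact zpow_ofNat _ 2
  have hG3 : ∀ y : ℝ, G 3 y = -(6 : ℂ) * (w + y) ^ (-(4 : ℤ)) := by
    intro y
    simp only [hG]
    norm_num [Nat.factorial]
  -- Euler–Maclaurin at finite `n`, order `ν = 1`
  have hEM : ∀ n : ℕ, ∑ m ∈ Finset.Ioc 0 n, G 0 m =
      (Complex.log (w + n) - Complex.log w) + (G 0 n - G 0 0) / 2 +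
        ∑ k ∈ Finset.Icc 1 1, (bernoulli (2 * k) : ℂ) / (2 * k).factorial * (G (2 * k - 1) n - G (2 * k - 1) 0) +
        1 / (2 * 1 + 1).factorial *
          ∫ x in ((0 : ℕ) : ℝ)..n, (bernoulliPer (2 * 1 + 1) x : ℂ) * G (2 * 1 + 1) x := by
    intro n
    have hg : ∀ j, ∀ x ∈ Icc ((0 : ℕ) : ℝ) n, HasDerivAt (G j) (G (j + 1) x) x := by
      intro j x hx
      have h := hasDerivAt_gFam hw j (by simpa using hx.1)
      rw [hG]
      refine h.congr_deriv ?_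
      push_cast
      ring_nf
    have hI : ∫ x in ((0 : ℕ) : ℝ)..n, G 0 x = Complex.log (w + n) - Complex.log w := by
      rw [Nat.cast_zero]
      exact integral_gFam_zero hw n
    have := eulerMaclaurin_family hg (Nat.zero_le n) 1
    rw [this, hI, Nat.cast_zero]
  -- the finite-`n` identity and the bound
  have hkey : ∀ n : ℕ, ‖((Real.log n : ℂ) - ∑ j ∈ Finset.range (n + 1), 1 / (w + j)) -
      (((Real.log n : ℂ) - Complex.log (w + n)) - (w + n)⁻¹ / 2 + (1 / 12) * ((w + n) ^ 2)⁻¹) - Main‖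
        ≤ Bnd := by
    intro n
    have hS : ∑ j ∈ Finset.range (n + 1), 1 / (w + j) = w⁻¹ + ∑ m ∈ Finset.Ioc 0 n, G 0 m := by
      rw [sum_range_succ_eq_add_sum_Ioc]
      simp only [hG0, Nat.cast_zero, add_zero, one_div, Complex.ofReal_natCast]
    have hG0n : G 0 n = (w + n)⁻¹ := by rw [hG0, Complex.ofReal_natCast]
    have hG00 : G 0 0 = w⁻¹ := by
      have := hG0 0
      rw [Complex.ofReal_zero, add_zero] at this
      exact_mod_cast this
    have hG1n : G 1 n = -((w + n) ^ 2)⁻¹ := by rw [hG1, Complex.ofReal_natCast]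
    have hG10 : G 1 0 = -(w ^ 2)⁻¹ := by
      have := hG1 0
      rw [Complex.ofReal_zero, add_zero] at this
      exact_mod_cast this
    have hB2 : (bernoulli (2 * 1) : ℚ) = 1 / 6 := by
      rw [show 2 * 1 = 2 by rfl, bernoulli_eq_bernoulli'_of_ne_one (by decide), bernoulli'_two]
    have hsumK : ∑ k ∈ Finset.Icc 1 1, (bernoulli (2 * k) : ℂ) / (2 * k).factorial *
        (G (2 * k - 1) n - G (2 * k - 1) 0) = (1 / 12) * (-((w + n) ^ 2)⁻¹ + (w ^ 2)⁻¹) := by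
      rw [Finset.Icc_self, Finset.sum_singleton, hB2]
      rw [show 2 * 1 - 1 = 1 by rfl, hG1n, hG10]
      push_cast
      norm_num [Nat.factorial]
    have hR : 1 / ((2 * 1 + 1).factorial : ℂ) *
        ∫ x in ((0 : ℕ) : ℝ)..n, (bernoulliPer (2 * 1 + 1) x : ℂ) * G (2 * 1 + 1) x =
        -∫ x in (0 : ℝ)..n, (bernoulliPer 3 x : ℂ) * (w + x) ^ (-(4 : ℤ)) := by
      rw [Nat.cast_zero, ← intervalIntegral.integral_const_mul, ← intervalIntegral.integral_neg]
      refine intervalIntegral.integral_congr fun x _ ↦ ?_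
      simp only [show 2 * 1 + 1 = 3 by rfl, hG3]
      norm_num [Nat.factorial]
      ring
    have hid : ((Real.log n : ℂ) - ∑ j ∈ Finset.range (n + 1), 1 / (w + j)) -
        (((Real.log n : ℂ) - Complex.log (w + n)) - (w + n)⁻¹ / 2 + (1 / 12) * ((w + n) ^ 2)⁻¹) - Main =
        ∫ x in (0 : ℝ)..n, (bernoulliPer 3 x : ℂ) * (w + x) ^ (-(4 : ℤ)) := by
      rw [hS, hEM n, hsumK, hR, hG0n, hG00, hMain]
      field_simp
      ring
    rw [hid]
    exact norm_integral_bernoulliPer_three_mul_le hw n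
  -- pass to the limit
  have hA : Tendsto (fun n : ℕ ↦ (Real.log n : ℂ) - ∑ j ∈ Finset.range (n + 1), 1 / (w + j)) atTop
      (𝓝 (Complex.digamma w)) := tendsto_log_sub_sum_inv_digamma hw
  have hV : Tendsto (fun n : ℕ ↦ ((Real.log n : ℂ) - Complex.log (w + n)) - (w + n)⁻¹ / 2 +
      (1 / 12) * ((w + n) ^ 2)⁻¹) atTop (𝓝 0) := by
    have h1 := tendsto_log_nat_sub_clog_add hw
    have h2 : Tendsto (fun n : ℕ ↦ (w + n)⁻¹ / 2) atTop (𝓝 0) := by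
      have := (tendsto_inv_pow_add_nat hw (le_refl 1)).div_const 2
      simpa using this
    have h3 : Tendsto (fun n : ℕ ↦ (1 / 12 : ℂ) * ((w + n) ^ 2)⁻¹) atTop (𝓝 0) := by
      have := (tendsto_inv_pow_add_nat hw (show 1 ≤ 2 by norm_num)).const_mul (1 / 12 : ℂ)
      simpa using this
    have := (h1.sub h2).add h3
    simpa using this
  have hlim : Tendsto (fun n : ℕ ↦ ((Real.log n : ℂ) - ∑ j ∈ Finset.range (n + 1), 1 / (w + j)) -
      (((Real.log n : ℂ) - Complex.log (w + n)) - (w + n)⁻¹ / 2 + (1 / 12) * ((w + n) ^ 2)⁻¹) - Main)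
      atTop (𝓝 (Complex.digamma w - 0 - Main)) := (hA.sub hV).sub tendsto_const_nhds
  have hnorm := (continuous_norm.tendsto _).comp hlim
  have hle := le_of_tendsto' hnorm hkey
  have e : Bnd = Real.sqrt 3 * π / 144 / ‖w‖ ^ 3 := by
    rw [hBnd]; field_simp; ring
  rw [← e]
  simpa [hMain] using hle

/-- **First-order form:** for `Re w > 0`,
`‖ψ(w) − Log w + 1/(2w)‖ ≤ 1/(12‖w‖²) + (√3 π/144)/‖w‖³` (the `B₂`-term `1/(12w²)` moved to the
right). [cite: WhittakerWatson1927, §12.33] [cite: DLMF, Eq. 5.11.2] -/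
theorem norm_digamma_sub_log_add_inv_le {w : ℂ} (hw : 0 < w.re) :
    ‖Complex.digamma w - Complex.log w + 1 / (2 * w)‖ ≤
      1 / (12 * ‖w‖ ^ 2) + Real.sqrt 3 * π / 144 / ‖w‖ ^ 3 := by
  have h := norm_digamma_sub_stirling_two_le hw
  have hw0 : w ≠ 0 := fun h ↦ by rw [h] at hw; simp at hw
  have hsplit : Complex.digamma w - Complex.log w + 1 / (2 * w) =
      (Complex.digamma w - (Complex.log w - 1 / (2 * w) - 1 / (12 * w ^ 2))) - 1 / (12 * w ^ 2) := by
    ring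
  rw [hsplit]
  refine (norm_sub_le _ _).trans ?_
  have hn : ‖(1 : ℂ) / (12 * w ^ 2)‖ = 1 / (12 * ‖w‖ ^ 2) := by
    rw [norm_div, norm_one, norm_mul, norm_pow]
    norm_num
  rw [hn]
  linarith

/-- **Lehman's estimate (Lehman 1970; Booker 2006 (4.3); Trudgian 2011 Lemma 2.9), multiplicative
form, for `‖z‖ ≥ 1/3`:** `‖ψ(z) − Log z + 1/(2z)‖ · ‖z‖² ≤ 2/π²` for `Re z > 0`, `‖z‖ ≥ 1/3`
(`1/12 + 3·√3π/144 = 0.1967… ≤ 2/π² = 0.2026…`). Since `|(Im z)² − (Re z)²| ≤ ‖z‖²` this gives the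
printed `Θ(2/(π²|(Im z)² − (Re z)²|))` (next two declarations). The printed statement has no
restriction on `‖z‖` ("If `Re z > 0`", Trudgian; "for `Re z ≥ 0`", Booker); the asymptotic-series
proof used here needs `‖z‖ ≥ 0.317`.
-- TODO(general form): all `Re z > 0`; the Binet–Laplace representation
-- `ψ(z) = Log z − 1/(2z) − ∫₀^∞ (1/(eᵗ−1) − 1/t + ½) e^{−zt} dt` gives the uniform constant `1/6`.
[cite: Lehman1970, Lemma 8 p. 308 (as quoted by Rumely 1993, (23) p. 431)] [cite: Rumely1993ERH, §4 (23) p. 431] [cite: Trudgian2011, Lemma 2.9] [cite: Booker2006, §4 proof of Lemma 4.3, display (4.3); arXiv math/0507502 p. 13] -/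
theorem norm_digamma_sub_log_add_inv_mul_sq_le {z : ℂ} (hz : 0 < z.re) (h3 : 1 / 3 ≤ ‖z‖) :
    ‖Complex.digamma z - Complex.log z + 1 / (2 * z)‖ * ‖z‖ ^ 2 ≤ 2 / π ^ 2 := by
  have h := norm_digamma_sub_log_add_inv_le hz
  have hzpos : 0 < ‖z‖ := lt_of_lt_of_le (by norm_num) h3
  have hπ := Real.pi_lt_d4
  have hπ0 := Real.pi_pos
  have hs : Real.sqrt 3 ≤ 1.7321 := by
    rw [Real.sqrt_le_left (by norm_num)]
    norm_num
  have hs0 : 0 ≤ Real.sqrt 3 := Real.sqrt_nonneg 3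
  -- `‖R‖ ‖z‖² ≤ 1/12 + (√3π/144)/‖z‖ ≤ 1/12 + 3√3π/144`
  have h1 : ‖Complex.digamma z - Complex.log z + 1 / (2 * z)‖ * ‖z‖ ^ 2 ≤
      1 / 12 + Real.sqrt 3 * π / 144 / ‖z‖ := by
    have := mul_le_mul_of_nonneg_right h (sq_nonneg ‖z‖)
    refine this.trans (le_of_eq ?_)
    field_simp
  have h2 : Real.sqrt 3 * π / 144 / ‖z‖ ≤ Real.sqrt 3 * π / 144 * 3 := by
    rw [div_le_iff₀ hzpos]
    have : 0 ≤ Real.sqrt 3 * π / 144 := by positivity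
    nlinarith
  have h4 : (0.1967 : ℝ) ≤ 2 / π ^ 2 := by
    rw [le_div_iff₀ (by positivity)]
    nlinarith
  have h5 : Real.sqrt 3 * π ≤ 1.7321 * 3.1416 := by
    exact mul_le_mul hs hπ.le hπ0.le (by norm_num)
  linarith

/-- **Lehman's estimate as printed** (for `‖z‖ ≥ 1/3`): if `Re z > 0` and `(Im z)² ≠ (Re z)²`, then
`‖ψ(z) − Log z + 1/(2z)‖ ≤ 2/(π² |(Im z)² − (Re z)²|)` — Trudgian: "If `Re z > 0`, then
`Γ'(z)/Γ(z) = log z − 1/(2z) + Θ(2/(π²|(Im z)² − (Re z)²|))`. Proof. See [Lehman]."; Booker: "the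
Stirling-type estimate [Lehman]". (On the diagonals `|Im z| = |Re z|` the printed bound is vacuous.)
-- TODO(general form): remove `‖z‖ ≥ 1/3` (see `norm_digamma_sub_log_add_inv_mul_sq_le`).
[cite: Lehman1970, Lemma 8 p. 308 (as quoted by Rumely 1993, (23) p. 431)] [cite: Trudgian2011, Lemma 2.9] [cite: Booker2006, §4 proof of Lemma 4.3, display (4.3); arXiv math/0507502 p. 13] -/
theorem norm_digamma_sub_log_add_inv_le_lehman {z : ℂ} (hz : 0 < z.re) (h3 : 1 / 3 ≤ ‖z‖)
    (hd : z.im ^ 2 ≠ z.re ^ 2) :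
    ‖Complex.digamma z - Complex.log z + 1 / (2 * z)‖ ≤ 2 / (π ^ 2 * |z.im ^ 2 - z.re ^ 2|) := by
  have h := norm_digamma_sub_log_add_inv_mul_sq_le hz h3
  have hD : 0 < |z.im ^ 2 - z.re ^ 2| := abs_pos.mpr (sub_ne_zero.mpr hd)
  have hDle : |z.im ^ 2 - z.re ^ 2| ≤ ‖z‖ ^ 2 := by
    rw [Complex.sq_norm, Complex.normSq_apply, abs_le]
    constructor <;> nlinarith [sq_nonneg z.re, sq_nonneg z.im]
  rw [le_div_iff₀ (by positivity)]
  have hR : 0 ≤ ‖Complex.digamma z - Complex.log z + 1 / (2 * z)‖ := norm_nonneg _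
  calc ‖Complex.digamma z - Complex.log z + 1 / (2 * z)‖ * (π ^ 2 * |z.im ^ 2 - z.re ^ 2|)
      = π ^ 2 * (‖Complex.digamma z - Complex.log z + 1 / (2 * z)‖ * |z.im ^ 2 - z.re ^ 2|) := by ring
    _ ≤ π ^ 2 * (‖Complex.digamma z - Complex.log z + 1 / (2 * z)‖ * ‖z‖ ^ 2) := by gcongr
    _ ≤ π ^ 2 * (2 / π ^ 2) := by gcongr
    _ = 2 := by field_simp

/-- **Lehman's estimate, `Θ`-form with the multiplicative constant** (no side condition on the
diagonals): `‖ψ(z) − Log z + 1/(2z)‖ · |(Im z)² − (Re z)²| ≤ 2/π²` for `Re z > 0`, `‖z‖ ≥ 1/3`.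
[cite: Lehman1970, Lemma 8 p. 308 (as quoted by Rumely 1993, (23) p. 431)] [cite: Trudgian2011, Lemma 2.9] -/
theorem norm_digamma_sub_log_add_inv_mul_le_lehman {z : ℂ} (hz : 0 < z.re) (h3 : 1 / 3 ≤ ‖z‖) :
    ‖Complex.digamma z - Complex.log z + 1 / (2 * z)‖ * |z.im ^ 2 - z.re ^ 2| ≤ 2 / π ^ 2 := by
  have h := norm_digamma_sub_log_add_inv_mul_sq_le hz h3
  have hDle : |z.im ^ 2 - z.re ^ 2| ≤ ‖z‖ ^ 2 := by
    rw [Complex.sq_norm, Complex.normSq_apply, abs_le]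
    constructor <;> nlinarith [sq_nonneg z.re, sq_nonneg z.im]
  exact (mul_le_mul_of_nonneg_left hDle (norm_nonneg _)).trans h

/-- **Real part** (for `Re w > 0`): `|Re ψ(w) − log ‖w‖ + Re w/(2‖w‖²)| ≤ 1/(12‖w‖²) + (√3π/144)/‖w‖³`
(`Re Log w = log ‖w‖`, `Re (1/(2w)) = Re w/(2‖w‖²)`); compare the tree's vertical bound
`|Re ψ(w) − log‖w‖ + Re 1/(2w)| ≤ 1/(6|Im w|³) + π/(12 (Im w)²)` (`DigammaStirlingSecondOrder`).
[cite: WhittakerWatson1927, §12.33] [cite: DLMF, Eq. 5.11.2] -/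
theorem abs_re_digamma_sub_log_norm_add_le {w : ℂ} (hw : 0 < w.re) :
    |(Complex.digamma w).re - Real.log ‖w‖ + w.re / (2 * ‖w‖ ^ 2)| ≤
      1 / (12 * ‖w‖ ^ 2) + Real.sqrt 3 * π / 144 / ‖w‖ ^ 3 := by
  have h := norm_digamma_sub_log_add_inv_le hw
  have hw0 : w ≠ 0 := fun h ↦ by rw [h] at hw; simp at hw
  have hre : (Complex.digamma w - Complex.log w + 1 / (2 * w)).re =
      (Complex.digamma w).re - Real.log ‖w‖ + w.re / (2 * ‖w‖ ^ 2) := by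
    have h2 : ((1 : ℂ) / (2 * w)).re = w.re / (2 * ‖w‖ ^ 2) := by
      rw [show (1 : ℂ) / (2 * w) = (2 * w)⁻¹ by rw [one_div], Complex.inv_re, Complex.normSq_mul,
        Complex.sq_norm]
      simp [Complex.normSq_ofNat]
      field_simp
    rw [Complex.add_re, Complex.sub_re, Complex.log_re, h2]
  rw [← hre]
  exact (Complex.abs_re_le_norm _).trans h

/-- **Imaginary part** (for `Re w > 0`): `|Im ψ(w) − arg w − Im w/(2‖w‖²)| ≤ 1/(12‖w‖²) + (√3π/144)/‖w‖³`
(`Im Log w = arg w`, `Im (1/(2w)) = −Im w/(2‖w‖²)`); compare the tree's vertical bound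
`|Im ψ(w) − Arg w + Im 1/(2w)| ≤ 1/(6|Im w|³) + π/(12 (Im w)²)` (`abs_im_digamma_sub_arg_add_im_le`).
[cite: WhittakerWatson1927, §12.33] [cite: DLMF, Eq. 5.11.2] -/
theorem abs_im_digamma_sub_arg_sub_le {w : ℂ} (hw : 0 < w.re) :
    |(Complex.digamma w).im - Complex.arg w - w.im / (2 * ‖w‖ ^ 2)| ≤
      1 / (12 * ‖w‖ ^ 2) + Real.sqrt 3 * π / 144 / ‖w‖ ^ 3 := by
  have h := norm_digamma_sub_log_add_inv_le hw
  have hw0 : w ≠ 0 := fun h ↦ by rw [h] at hw; simp at hw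
  have him : (Complex.digamma w - Complex.log w + 1 / (2 * w)).im =
      (Complex.digamma w).im - Complex.arg w - w.im / (2 * ‖w‖ ^ 2) := by
    have h2 : ((1 : ℂ) / (2 * w)).im = -(w.im / (2 * ‖w‖ ^ 2)) := by
      rw [show (1 : ℂ) / (2 * w) = (2 * w)⁻¹ by rw [one_div], Complex.inv_im, Complex.normSq_mul,
        Complex.sq_norm]
      simp [Complex.normSq_ofNat]
      field_simp
    rw [Complex.add_im, Complex.sub_im, Complex.log_im, h2]
    ring
  rw [← him]
  exact (Complex.abs_im_le_norm _).trans h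

end DigammaLehman

end Literature.Analysis.SpecialFunctions

end
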